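import Literature.RingTheory.MvPowerSeries.AdicTaylor
import Literature.AlgebraicGeometry.Resolution.HasseSchmidtDerivatives
import Literature.AlgebraicGeometry.Resolution.DiffOpFrobeniusLinear
import Literature.RingTheory.TwoVariableSeries.Basic
import Mathlib.Data.Nat.Choose.Vandermonde
import HarnessLib

/-!
# Divided derivatives of formal power series: Leibniz rule and differential-operator order

Topic `Literature/RingTheory/MvPowerSeries`, companion of `AdicTaylor.lean` (the divided / Hasse partial
derivatives `hasseDeriv α = Δ_α` of `A⟦X_s : s ∈ τ⟧`, defined there coefficientwise:
`coeff β (Δ_α f) = C(α+β, α) · coeff (α+β) f`).  For a FINITE index type `τ` this file proves: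

* `mchoose` (with the private Vandermonde lemma `mchoose_add_eq_sum_antidiagonal`) — the multi-index binomial `C(m, a) = Π_s C(m_s, a_s)` and the
  multivariate Vandermonde identity `C(i+j, α) = Σ_{a+b=α} C(i, a)·C(j, b)` (coordinatewise `Nat.add_choose_eq`);
* `hasseDeriv_mul` — the **higher Leibniz rule** `Δ_α(f g) = Σ_{a+b=α} Δ_a f · Δ_b g` for formal power series
  (Bourbaki: `f ↦ f(X+Y)` is a ring homomorphism and the `Δ_α f` are the coefficients of `Y^α`; here proved
  directly on coefficients by the Vandermonde identity);
* `commMul_hasseDeriv`, `isDiffOpLE_hasseDeriv` — hence `[Δ_α, g] = Σ_{a+b=α, a≠0} (Δ_a g)·Δ_b` and **`Δ_α` is a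
  differential operator of order `≤ |α|`** in the sense of the tree's `Resolution.IsDiffOpLE` (Grothendieck's
  recursive criterion EGA IV₄ 16.8.8 (b)); EGA IV₄ Thm. 16.11.2 («les `D_p` tels que `|p| ≤ m` forment une base
  du `𝒪_U`-Module `Diff^m`»). The proof is the one of the polynomial case already in the tree
  (`Resolution.isDiffOpLE_hasseDeriv`, file `Resolution/HasseSchmidtDerivatives.lean`), run on power series;
* `hasseDeriv_apply_pow_char_pow_mul` — corollary in characteristic `p`: **`Δ_α (f^{p^N} · g) = f^{p^N} · Δ_α g`
  whenever `|α| < p^N`** (operators of order `< p^N` are linear over `p^N`-th powers: the tree's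
  `Resolution.IsDiffOpLE.apply_pow_char_pow_mul'`, Abad 2019 Lem. 6.2 / Giraud).

Everything here is PROVED (no named facts). Bearing (index only, nothing of it is used): in the res-hironaka
campaign (LADDER-RESOLUTION rung M) the operators `∂_X` «in the sense of Eq. (8)» of H. Hironaka's 2017 manuscript
act on `K[[x]]` exactly as `hasseDeriv X`; the GAP-LEDGER rows on `ρ^ℓ(O)`-linearity of these operators (R72, R53)
consume the last corollary as a library fact.

## References

* N. Bourbaki, *Algèbre commutative*, Ch. III §4 no. 5, formula (21) (the `Δ_α f` as coefficients of
  `f(X+Y)`). [Bourbaki1989CommAlg]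
* A. Grothendieck, J. Dieudonné, ÉGA IV₄, Publ. Math. IHÉS 32 (1967), Thm. 16.11.2 (held: lit key
  `paper:doi-10-1007-bf02732123`, p0053: (16.11.2.1) `D_p(z^q) = C(q,p) z^{q−p}`; «pour tout entier `m`, les `D_p`
  tels que `|p| ≤ m` forment une base du `𝒪_U`-Module `Diff^m_{U/S}`»), Prop. 16.8.8 (b). [EGAIV4]
* H. Matsumura, *Commutative Ring Theory*, §27 (higher derivations: the Leibniz rule `D_n(ab) = Σ D_i(a) D_{n−i}(b)`).
  [Matsumura1987]
* C. Abad, J. Algebra 523 (2019), Lemma 6.2 (order `< p^e` ⇒ `k[A^{p^e}]`-linear). [Abad2019pBases]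
-/

noncomputable section

namespace Literature.RingTheory.MvPowerSeries

open _root_.MvPowerSeries Finset
open Literature.AlgebraicGeometry.Resolution (commMul commMul_apply IsDiffOpLE isDiffOpLE_id
  degree_snd_lt_of_mem_erase_antidiagonal)

universe u v

variable {A : Type u} [CommRing A] {τ : Type v} [Fintype τ] [DecidableEq τ]

/-! ### The multi-index binomial and the multivariate Vandermonde identity -/

/-- The multi-index binomial coefficient `C(m, a) = Π_s C(m_s, a_s)` (zero unless `a ≤ m`). [folklore] -/
def mchoose (m a : τ →₀ ℕ) : ℕ := ∏ s, (m s).choose (a s)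

omit [DecidableEq τ] in
/-- `C(m, a) = 0` unless `a ≤ m` coordinatewise. [folklore] -/
private theorem mchoose_eq_zero_of_not_le {m a : τ →₀ ℕ} (h : ¬ a ≤ m) : mchoose m a = 0 := by
  obtain ⟨s, hs⟩ : ∃ s, ¬ a s ≤ m s := not_forall.mp fun h' => h (Finsupp.le_def.mpr h')
  exact Finset.prod_eq_zero (Finset.mem_univ s) (Nat.choose_eq_zero_of_lt (not_le.mp hs))

omit [DecidableEq τ] in
/-- The binomial of `AdicTaylor.coeff_hasseDeriv` is `mchoose (α + β) α`. [folklore] -/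
private theorem prod_choose_eq_mchoose (α β : τ →₀ ℕ) :
    ((α + β).prod fun s n => n.choose (α s)) = mchoose (α + β) α := by
  rw [prod_choose_eq]
  exact Finset.prod_congr rfl fun s _ => by rw [Finsupp.add_apply]

omit [DecidableEq τ] in
/-- Coefficients of `Δ_α f` with the multi-index binomial: `coeff β (Δ_α f) = C(α+β, α) · coeff (α+β) f`.
[cite: Bourbaki1989CommAlg, Ch. III §4 no. 5 (21)] -/
theorem coeff_hasseDeriv_mchoose (α β : τ →₀ ℕ) (f : MvPowerSeries τ A) :
    coeff β (hasseDeriv α f) = (mchoose (α + β) α : A) * coeff (α + β) f := by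
  rw [coeff_hasseDeriv, prod_choose_eq_mchoose]

/-- **Multivariate Vandermonde identity**: `C(i + j, α) = Σ_{(a,b) : a+b=α} C(i, a) · C(j, b)`
(coordinatewise `Nat.add_choose_eq`, multiplied out over the finite index type). [folklore] -/
private theorem mchoose_add_eq_sum_antidiagonal (i j α : τ →₀ ℕ) :
    mchoose (i + j) α = ∑ p ∈ antidiagonal α, mchoose i p.1 * mchoose j p.2 := by
  classical
  unfold mchoose
  have h1 : (∏ s, (i s + j s).choose (α s)) =
      ∏ s, ∑ kl ∈ antidiagonal (α s), (i s).choose kl.1 * (j s).choose kl.2 :=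
    Finset.prod_congr rfl fun s _ => Nat.add_choose_eq _ _ _
  simp only [Finsupp.add_apply]
  rw [h1, Finset.prod_univ_sum]
  -- reindex the functions `φ : Π s, antidiagonal (α s)` by pairs `(a, b)` with `a + b = α`
  refine Finset.sum_nbij'
    (fun φ => (Finsupp.equivFunOnFinite.symm fun s => (φ s).1,
      Finsupp.equivFunOnFinite.symm fun s => (φ s).2))
    (fun p => fun s => (p.1 s, p.2 s)) ?_ ?_ ?_ ?_ ?_
  · intro φ hφ
    rw [Fintype.mem_piFinset] at hφ
    rw [HasAntidiagonal.mem_antidiagonal]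
    ext s
    rw [Finsupp.add_apply, Finsupp.coe_equivFunOnFinite_symm, Finsupp.coe_equivFunOnFinite_symm]
    exact HasAntidiagonal.mem_antidiagonal.mp (hφ s)
  · intro p hp
    rw [HasAntidiagonal.mem_antidiagonal] at hp
    rw [Fintype.mem_piFinset]
    intro s
    rw [HasAntidiagonal.mem_antidiagonal, ← Finsupp.add_apply, hp]
  · intro φ _
    funext s
    simp only [Finsupp.coe_equivFunOnFinite_symm]
  · intro p _
    ext s <;> simp only [Finsupp.coe_equivFunOnFinite_symm]
  · intro φ _
    rw [Finset.prod_mul_distrib]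
    simp only [Finsupp.coe_equivFunOnFinite_symm]

/-! ### The higher Leibniz rule -/

omit [Fintype τ] in
/-- Shifting the antidiagonal: for `a + b = α`, summing `H (a + c) (b + d)` over `c + d = β` is summing
`H i j` over `i + j = α + β`, provided `H i j` vanishes unless `a ≤ i` and `b ≤ j`. [folklore] -/
private theorem sum_antidiagonal_shift {M : Type*} [AddCommMonoid M] {α β : τ →₀ ℕ}
    {ab : (τ →₀ ℕ) × (τ →₀ ℕ)} (hab : ab ∈ antidiagonal α) (H : (τ →₀ ℕ) → (τ →₀ ℕ) → M)
    (hH : ∀ i j, ¬ (ab.1 ≤ i ∧ ab.2 ≤ j) → H i j = 0) :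
    ∑ cd ∈ antidiagonal β, H (ab.1 + cd.1) (ab.2 + cd.2) = ∑ ij ∈ antidiagonal (α + β), H ij.1 ij.2 := by
  classical
  rw [HasAntidiagonal.mem_antidiagonal] at hab
  rw [← Finset.sum_filter_add_sum_filter_not (antidiagonal (α + β)) (fun ij => ab.1 ≤ ij.1 ∧ ab.2 ≤ ij.2),
    Finset.sum_eq_zero (s := (antidiagonal (α + β)).filter fun ij => ¬ (ab.1 ≤ ij.1 ∧ ab.2 ≤ ij.2))
      (fun ij hij => hH ij.1 ij.2 (Finset.mem_filter.mp hij).2), add_zero]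
  refine Finset.sum_nbij' (fun cd => (ab.1 + cd.1, ab.2 + cd.2)) (fun ij => (ij.1 - ab.1, ij.2 - ab.2))
    ?_ ?_ ?_ ?_ ?_
  · intro cd hcd
    rw [HasAntidiagonal.mem_antidiagonal] at hcd
    rw [Finset.mem_filter, HasAntidiagonal.mem_antidiagonal]
    refine ⟨?_, le_self_add, le_self_add⟩
    rw [add_add_add_comm, hab, hcd]
  · intro ij hij
    rw [Finset.mem_filter, HasAntidiagonal.mem_antidiagonal] at hij
    obtain ⟨hsum, h1, h2⟩ := hij
    rw [HasAntidiagonal.mem_antidiagonal, tsub_add_tsub_comm h1 h2, hsum, ← hab, add_tsub_cancel_left]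
  · intro cd _
    simp only [add_tsub_cancel_left]
  · intro ij hij
    rw [Finset.mem_filter] at hij
    obtain ⟨_, h1, h2⟩ := hij
    simp only [add_tsub_cancel_of_le h1, add_tsub_cancel_of_le h2]
  · intro cd _
    rfl

/-- **Higher Leibniz rule for the divided derivatives of formal power series**:
`Δ_α (f · g) = Σ_{a+b=α} Δ_a f · Δ_b g` (finite index type). Bourbaki obtains the `Δ_α f` as the
coefficients of `Y^α` in `f(X+Y)`, and `f ↦ f(X+Y)` is a ring homomorphism; the proof here compares
coefficients directly, by the multivariate Vandermonde identity. [cite: Bourbaki1989CommAlg, Ch. III §4 no. 5 (21)]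
[cite: Matsumura1987, §27 (higher derivations: Leibniz rule)] -/
theorem hasseDeriv_mul (α : τ →₀ ℕ) (f g : MvPowerSeries τ A) :
    hasseDeriv α (f * g) = ∑ ab ∈ antidiagonal α, hasseDeriv ab.1 f * hasseDeriv ab.2 g := by
  classical
  ext β
  rw [coeff_hasseDeriv_mchoose, coeff_mul, map_sum, Finset.mul_sum]
  -- right-hand side, coefficientwise
  have hR : ∀ ab ∈ antidiagonal α,
      coeff β (hasseDeriv ab.1 f * hasseDeriv ab.2 g) =
        ∑ ij ∈ antidiagonal (α + β),
          ((mchoose ij.1 ab.1 : A) * (mchoose ij.2 ab.2 : A)) * (coeff ij.1 f * coeff ij.2 g) := by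
    intro ab hab
    rw [coeff_mul]
    simp only [coeff_hasseDeriv_mchoose]
    rw [← sum_antidiagonal_shift hab
      (fun i j => ((mchoose i ab.1 : A) * (mchoose j ab.2 : A)) * (coeff i f * coeff j g))]
    · exact Finset.sum_congr rfl fun cd _ => by ring
    · intro i j hij
      rcases not_and_or.mp hij with h | h
      · rw [mchoose_eq_zero_of_not_le h, Nat.cast_zero, zero_mul, zero_mul]
      · rw [mchoose_eq_zero_of_not_le h, Nat.cast_zero, mul_zero, zero_mul]
  rw [Finset.sum_congr rfl hR, Finset.sum_comm]
  refine Finset.sum_congr rfl fun ij hij => ?_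
  rw [← Finset.sum_mul]
  congr 1
  rw [HasAntidiagonal.mem_antidiagonal] at hij
  rw [← hij, mchoose_add_eq_sum_antidiagonal, Nat.cast_sum]
  exact Finset.sum_congr rfl fun ab _ => by rw [Nat.cast_mul]

/-! ### `Δ_α` is a differential operator of order `≤ |α|` -/

omit [Fintype τ] [DecidableEq τ] in
/-- `Δ_0 = id` as linear maps (power series). [cite: Bourbaki1989CommAlg, Ch. III §4 no. 5 (21)] -/
theorem hasseDeriv_zero_eq_id : hasseDeriv (0 : τ →₀ ℕ) = (LinearMap.id : MvPowerSeries τ A →ₗ[A] _) :=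
  LinearMap.ext hasseDeriv_zero

/-- **The commutator of `Δ_α` with a multiplication** (power series): `[Δ_α, g] = Σ_{a+b=α, (a,b)≠(0,α)}
(Δ_a g) · Δ_b` — Leibniz rule minus its `a = 0` term. [cite: EGAIV4, Prop. 16.8.8 (b) with Thm. 16.11.2] -/
theorem commMul_hasseDeriv (α : τ →₀ ℕ) (g : MvPowerSeries τ A) :
    commMul A (hasseDeriv α) g =
      ∑ ab ∈ (antidiagonal α).erase (0, α), hasseDeriv ab.1 g • hasseDeriv (A := A) ab.2 := by
  classical
  refine LinearMap.ext fun t => ?_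
  have h0 : ((0 : τ →₀ ℕ), α) ∈ antidiagonal α := by simp
  rw [commMul_apply, hasseDeriv_mul, ← Finset.add_sum_erase _ _ h0, LinearMap.sum_apply]
  simp only [hasseDeriv_zero, LinearMap.smul_apply, smul_eq_mul]
  ring

/-- **`Δ_α` is a differential operator of order `≤ |α|` on `A⟦X⟧`, in every characteristic**
(Grothendieck's recursive criterion: induction on `|α|` through `commMul_hasseDeriv`).
[cite: EGAIV4, Thm. 16.11.2 (the D_p with |p| ≤ m lie in, indeed form a basis of, Diff^m)] -/
theorem isDiffOpLE_hasseDeriv :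
    ∀ (n : ℕ) (α : τ →₀ ℕ), α.degree ≤ n → IsDiffOpLE A n (hasseDeriv (A := A) (τ := τ) α)
  | 0, α, hα => by
    have : α = 0 := (Finsupp.degree_eq_zero_iff α).1 (Nat.le_zero.1 hα)
    subst this
    rw [hasseDeriv_zero_eq_id]
    exact isDiffOpLE_id
  | n + 1, α, hα => fun g => by
    classical
    rw [commMul_hasseDeriv]
    refine IsDiffOpLE.sum _ fun ab hab => IsDiffOpLE.smul _ (isDiffOpLE_hasseDeriv n ab.2 ?_)
    have := degree_snd_lt_of_mem_erase_antidiagonal hab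
    omega

/-! ### Characteristic `p`: `Δ_α` is linear over `p^N`-th powers when `|α| < p^N` -/

/-- **`Δ_α (f^{p^N} · g) = f^{p^N} · Δ_α g` for `|α| < p^N` in characteristic `p`**: a differential operator
of order `< p^N` is linear over the `p^N`-th powers (`isDiffOpLE_hasseDeriv` with the tree's
`IsDiffOpLE.apply_pow_char_pow_mul'`, Abad 2019 Lem. 6.2). [cite: Abad2019pBases, Lemma 6.2] -/
theorem hasseDeriv_apply_pow_char_pow_mul (p : ℕ) [Fact p.Prime] [CharP A p] {N : ℕ} {α : τ →₀ ℕ}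
    (hα : α.degree < p ^ N) (f g : MvPowerSeries τ A) :
    hasseDeriv α (f ^ p ^ N * g) = f ^ p ^ N * hasseDeriv α g := by
  haveI : CharP (MvPowerSeries τ A) p := Literature.RingTheory.TwoVariableSeries.charP_mvPowerSeries τ p
  exact (isDiffOpLE_hasseDeriv α.degree α le_rfl).apply_pow_char_pow_mul' p hα f g

/-- The same for every element of `ρ^N(A⟦X⟧) = {u : u = v^{p^N}}`: `Δ_α (u · g) = u · Δ_α g` when `|α| < p^N`.
[cite: Abad2019pBases, Lemma 6.2] -/
theorem hasseDeriv_apply_mul_of_mem_range_iterateFrobenius (p : ℕ) [Fact p.Prime] [CharP A p] {N : ℕ}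
    {α : τ →₀ ℕ} (hα : α.degree < p ^ N) {u : MvPowerSeries τ A}
    (hu : ∃ v : MvPowerSeries τ A, v ^ p ^ N = u) (g : MvPowerSeries τ A) :
    hasseDeriv α (u * g) = u * hasseDeriv α g := by
  obtain ⟨v, rfl⟩ := hu
  exact hasseDeriv_apply_pow_char_pow_mul p hα v g

end Literature.RingTheory.MvPowerSeries
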